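import Mathlib
import Literature.Topology.FourManifolds.PlanarAchiralWords
import Literature.Topology.FourManifolds.PlanarShadowWalk
import Literature.Topology.FourManifolds.PlanarShadowDouble
import HarnessLib

/-!
# Stub `stub_shadowWalkK4` of line `Sketch` (crux `ConvexBisection.PlanarAcyclicBisectionRigidity`,
stmt-SmoothPoincare4-15086) — THE LEVER K4-WALK, PROVED

The registered lever of the line (skeleton
`Cruxes/PlanarAcyclicBisectionRigidity/Lines/Sketch.lean`, Stub 2): for every `w ∈ F₂` and every
two ordered pairs `P, Q ∈ XYPairs w` of (conjugate of `x`, conjugate of `y`) with product `w`,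
the shadow block word `startState P Q = [P.1, P.2, Q.2⁻¹, Q.1⁻¹]` is carried by signed Hurwitz
moves (`Literature.Topology.FourManifolds.PlanarShadow.Reachable`) to a ball state or an honest
double.  It is proved in the DOUBLE form by the peak-reduction theorem
`Literature.Topology.FourManifolds.PlanarShadow.reach_double_startState`
(`Literature/Topology/FourManifolds/PlanarShadowDouble.lean`, over `PlanarShadowJunctions.lean`
and the cancellation calculus `NielsenCancellation.lean`): every four-letter state of core
letters with trivial product descends, by length-reducing Hurwitz moves (Artin 1947, §§7–9), to
an adjacent cancelling pair and then, by at most four more moves, to `[g₁, g₂, g₂⁻¹, g₁⁻¹]`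
with `g₁, g₂` positive.  In the crux line this is the `n = 3` (`k = 4`) case of the seam walk:
through `stub_k4Lift` and the dictionary, every planar-bisected homotopy 4-sphere with four
binding components is the double of a contractible planar Stein domain (Mazur type or `B⁴`).

Census confirmation (lead's engine `work/engine/k4engine.py`, `peak.py`): greedy length
reduction reaches a cancelling pair from all 13 two-axis words of flank ≤ 8 and from 2000 random
states, never stuck — as the theorem predicts.  The ball target is NOT always reachable (it needs
the walk invariant `⟨P.1, P.2, Q.1⟩ = F₂`; the `s`/`t`-twins of cyclic length 18 have a proper
subgroup), which is why the lever is settled through the double.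
-/

noncomputable section

open scoped Manifold ContDiff Topology ContinuousMap
open Set Function
open Literature.Topology.FourManifolds.PlanarWords
open Literature.Topology.FourManifolds.PlanarShadow (F₂ IsPos XYPairs startState IsBallState
  IsDoubleState InShadowNormalForm)

-- the prescribed namespace `Summit.<P>.<Sub>.…` duplicates `SmoothPoincare4` (P = Sub)
set_option linter.dupNamespace false

namespace Summit.SmoothPoincare4.SmoothPoincare4.Theorems.PlanarAcyclicBisectionRigidity.Sketch

/-- **Stub 2 of line `Sketch` — THE LEVER K4-WALK (proved, double form).**  For every `w ∈ F₂`
and every two ordered pairs `P = (a₁, a₂)`, `Q = (b₁, b₂)` of (conjugate of `x`, conjugate of `y`)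
with `a₁ a₂ = b₁ b₂ = w`, the shadow block word `[a₁, a₂, b₂⁻¹, b₁⁻¹]` is carried by signed
Hurwitz moves and their inverses at the three linear positions to a state containing the chain
`(c x c⁻¹, c y c⁻¹)` (ball) or to an honest double `[g₁, g₂, g₂⁻¹, g₁⁻¹]` with `g₁, g₂` positive —
in fact always to the latter (`PlanarShadow.reach_double_startState`: peak reduction of
`Σ‖ℓᵢ‖`, then eight explicit endgames).  Registered signature verbatim. [folklore] -/
theorem stub_shadowWalkK4 (w : F₂) (P Q : F₂ × F₂) (hP : P ∈ XYPairs w) (hQ : Q ∈ XYPairs w) :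
    ∃ t : List F₂, Literature.Topology.FourManifolds.PlanarShadow.Reachable (startState P Q) t ∧
      (IsBallState t ∨ IsDoubleState t) := by
  obtain ⟨t, ht, hd⟩ :=
    Literature.Topology.FourManifolds.PlanarShadow.reach_double_startState w P Q hP hQ
  exact ⟨t, ht, Or.inr hd⟩

end Summit.SmoothPoincare4.SmoothPoincare4.Theorems.PlanarAcyclicBisectionRigidity.Sketch

end
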